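import Summits.BirchSwinnertonDyer.Rank1Residual.ManinAdditive.ThreeIsogenyKernelLaws
import Summits.BirchSwinnertonDyer.BirchSwinnertonDyer.Theorems.ManinLocalTwoThreeThreeTorsionIsogenyAscent
import HarnessLib

/-!
# (VÉLU₃♯) `VeluAscendingEdgeOfCongruenceAtNine` DISCHARGED: `veluAscendingEdgeOfCongruenceAtNine_holds`
# (cell `bsd-f2-manin`; the `…Holds` sibling of the conjecture leaf `ThreeIsogenyKernelLaws`, typer g13)

The lead's Vélu–Kraus dictionary row (VÉLU₃♯) `ThreeIsogenyKernel.VeluAscendingEdgeOfCongruenceAtNine` (p645148; filed as an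
`@[conjecture]` obligation «dictionary-grade, needs `Isogeny` existence») is a THEOREM in the tree:
`Summit.BirchSwinnertonDyer.BirchSwinnertonDyer.Theorems.ManinLocalTwoThree.veluAscendingEdgeOfCongruenceAtNine_holds`
(`Theorems/ManinLocalTwoThreeThreeTorsionIsogenyAscent.lean`, C2/C3 LEAD bsd-line-manin23-p1 gen 6, 2026-08-28T16:29:57Z /
16:4xZ: the quotient isogeny `φ : W → W/⟨T⟩ →` minimal model as a tree `Isogeny`, uniformisation and the lattice sandwich
`[Λ₂ : αΛ] = 3 ⟹ Λ₂ = α(Λ + ℤ z_T)`, `α ∣ 3`, `α ≠ ±1`, from p645684).  The LEAD's theorem already has the leaf's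
statement as its type (so no alias is re-declared here — the gate's dedup sees it as THE `_holds`); this file feeds it to the
leaf's PROVED composite `no_congruent_threeTorsion_of_laws`, whose only remaining hypothesis is an's NB₃^Λ₉ row
`NoConstantKernelAscendingThreeOptimalAtNine` (E-an-100₉).  The C3 skeleton v14 no longer uses either row as a stub
(NB₃ rests on NB₃^V `CuspidalKummerThree.NoAscendingThreeTorsionOptimal`); the rows stay filed as an's candidates.
PROVED lemmas only; axioms standard.  bears_on: stmt-BirchSwinnertonDyer-22968.  BSD is not proved by this; Manin's conjecture is
not proved by this; C3 is not closed by this.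
-/

noncomputable section

open CongruenceSubgroup WeierstrassCurve Literature.NumberTheory.DiophantineGeometry Literature.NumberTheory.EllipticCurves
  Literature.NumberTheory.EllipticCurves.ModularForms
  Summit.BirchSwinnertonDyer.Rank1Residual.ManinAdditive
  Summit.BirchSwinnertonDyer.Rank1Residual.ManinAdditive.CuspidalKummer
  Summit.BirchSwinnertonDyer.Rank1Residual.ManinAdditive.CuspidalKummerThree

namespace Summit.BirchSwinnertonDyer.Rank1Residual.ManinAdditive.ThreeIsogenyKernel

/-- The leaf's composite edge with (VÉLU₃♯) DISCHARGED: NB₃^Λ₉ alone (an's E-an-100₉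
`NoConstantKernelAscendingThreeOptimalAtNine`) forbids a `z⁹`-congruent rational `3`-torsion point on the intrinsic short model
of an `X₀(N)`-optimal curve at `9 ∣ N`. -/
theorem no_congruent_threeTorsion_of_noConstantKernelAscendingAtNine (h100 : NoConstantKernelAscendingThreeOptimalAtNine)
    (W : WeierstrassCurve ℚ) [W.IsElliptic] [W.IsGloballyMinimal] {N : ℕ} [NeZero N]
    (D : ModularParametrizationData W N) (hL : ∀ z ∈ D.L.lattice, ∃ w ∈ periodLattice D.f, z = D.c * w) (h9 : 9 ∣ N)
    (X₁ Y₁ : ℚ) (hT : IsShortThreeTorsion W 1 X₁ Y₁) :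
    ¬ ‖(((Y₁ - 4 * (tangentSlope W 1 X₁ Y₁ / 3) ^ 3) / 9 : ℚ) : ℚ_[3])‖ ≤ 1 :=
  no_congruent_threeTorsion_of_laws h100
    Summit.BirchSwinnertonDyer.BirchSwinnertonDyer.Theorems.ManinLocalTwoThree.veluAscendingEdgeOfCongruenceAtNine_holds
    W D hL h9 X₁ Y₁ hT

end Summit.BirchSwinnertonDyer.Rank1Residual.ManinAdditive.ThreeIsogenyKernel

end
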